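import Summits.RiemannHypothesis.RiemannHypothesis.Theorems.JensenLogBandArcSaddleDen
import Mathlib.Topology.MetricSpace.Contracting
import Mathlib.Analysis.Calculus.MeanValue
import HarnessLib

/-!
# Existence of the model saddle of the right half-arc transform (BAND line, step S3) — part 2

RH ladder column JENSEN, rung J-P(P3) «log band», BAND crux `XiDerivBandRealAllRates` of route
«JensenLogBand», line «band-one-window» (u-arc reshape), lead rh-jensen-prover g7 — step (S3) of
HOME/rh-jensen-prover/g7-work/LINE-PLAN.md §6, continued from `JensenLogBandArcSaddleDen.lean`
(which bounds the denominator `D(u)` of the fixed-point map on the disc `|u − (c+h)| ≤ (3/5)h`).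
RH-FREE (Γ-factor only; no `ζ`). WHAT THIS IS NOT: nothing here bears on zeros of `ζ` or the truth
of RH.

Here: the map `u ↦ c + n/D(u)` sends the disc into itself (`norm_div_saddleDen_sub_le`,
`‖n/D − h‖ ≤ (3/5)h`), is `½`-Lipschitz there (`hasDerivAt_div_saddleDen`,
`‖(n/D)′‖ = n‖D′‖/‖D‖² ≤ ½` from `‖λ″‖ ≤ 8.3/T`, eng-2 g5's `norm_xiGammaLogDeriv2_sub_le_of_re_nonneg`),
and Banach's fixed-point theorem (`ContractingWith.exists_fixedPoint'`) gives the saddle: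
**`exists_arcSaddleFn_eq_zero`** — for `|x| ≤ ½`, `T ≥ 100`, `ℓ_T ≥ 20`, `n ≥ 100`,
`½ ≤ h(n,T) ≤ (7/20)T`, there is `u*` with `S_{n,c}(u*) = 0` and `‖u* − (c + h(n,T))‖ ≤ (3/5)h(n,T)`.
-/

noncomputable section

-- single-problem summit: `Summit.RiemannHypothesis.RiemannHypothesis.…` is the tree convention
set_option linter.dupNamespace false

open Complex Real Set Metric

namespace Summit.RiemannHypothesis.RiemannHypothesis.Theorems.JensenPolynomials.LogBandArc

open Literature.NumberTheory.LFunctions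

section den

variable {n : ℕ} {x T : ℝ} {u : ℂ}

/-- **The fixed-point map stays in the disc:** `‖n/D(u) − h‖ ≤ (3/5) h` for `u` in the disc
(indeed `≤ 0.47 h`). [folklore] -/
theorem norm_div_saddleDen_sub_le (hx : |x| ≤ 1 / 2) (hT : 100 ≤ T) (hℓ : 20 ≤ ell T)
    (hn : 100 ≤ n) (hh : 1 / 2 ≤ bandRadius n T) (hhT : bandRadius n T ≤ 7 / 20 * T)
    (hu : ‖u - ((x : ℂ) + (T : ℂ) * I + bandRadius n T)‖ ≤ 3 / 5 * bandRadius n T) :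
    saddleDen n ((x : ℂ) + (T : ℂ) * I) u ≠ 0 ∧
    ‖(n : ℂ) / saddleDen n ((x : ℂ) + (T : ℂ) * I) u - bandRadius n T‖ ≤ 3 / 5 * bandRadius n T := by
  set h := bandRadius n T with hhdef
  set ℓ := ell T with hℓdef
  set D := saddleDen n ((x : ℂ) + (T : ℂ) * I) u with hD
  obtain ⟨hR_lo, hR_hi, hJ_lo, hJ_hi⟩ := saddleDen_re_im_bounds hx hT hℓ hh hhT hu
  rw [← hD] at hR_lo hR_hi hJ_lo hJ_hi
  have hhℓ : h * ℓ = 2 * ((n : ℝ) + 1) := bandRadius_mul_ell hℓ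
  have hn' : (100 : ℝ) ≤ n := by exact_mod_cast hn
  have hnormD : 9 / 20 * ℓ ≤ ‖D‖ := hR_lo.trans ((le_abs_self _).trans (Complex.abs_re_le_norm D))
  have hD0 : D ≠ 0 := by
    intro h0; rw [h0, norm_zero] at hnormD; linarith
  refine ⟨hD0, ?_⟩
  have hrew : (n : ℂ) / D - (h : ℂ) = ((n : ℂ) - (h : ℂ) * D) / D := by
    field_simp
  rw [hrew, norm_div, div_le_iff₀ (norm_pos_iff.2 hD0)]
  -- `‖n − h D‖ ≤ |n − h Re D| + h |Im D|`
  have hre : ((n : ℂ) - (h : ℂ) * D).re = (n : ℝ) - h * D.re := by simp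
  have him : ((n : ℂ) - (h : ℂ) * D).im = -(h * D.im) := by simp
  have hN := Complex.norm_le_abs_re_add_abs_im ((n : ℂ) - (h : ℂ) * D)
  rw [hre, him, abs_neg] at hN
  have h1 : |(n : ℝ) - h * D.re| ≤ 3 / 25 * ((n : ℝ) + 1) + 1 := by
    rw [abs_le]
    constructor
    · have : h * D.re ≤ h * (14 / 25 * ℓ) := mul_le_mul_of_nonneg_left hR_hi (by linarith)
      nlinarith only [this, hhℓ, hn']
    · have : h * (9 / 20 * ℓ) ≤ h * D.re := mul_le_mul_of_nonneg_left hR_lo (by linarith)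
      nlinarith only [this, hhℓ, hn']
  have h2 : |h * D.im| ≤ 9 / 10 * h + ((n : ℝ) + 1) / 5 := by
    rw [abs_le]
    constructor
    · have : h * (-(1 / 10)) ≤ h * D.im := mul_le_mul_of_nonneg_left hJ_lo (by linarith)
      nlinarith only [this, hhℓ, hn', hh]
    · have : h * D.im ≤ h * (9 / 10 + ℓ / 10) := mul_le_mul_of_nonneg_left hJ_hi (by linarith)
      nlinarith only [this, hhℓ]
  -- `(8/25)(n+1) + 1 + (9/10) h ≤ (3/5 h)(9/20 ℓ) = (27/100) h ℓ = (27/50)(n+1)` needs `1 + 0.9h ≤ 0.22(n+1)`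
  have h3 : 3 / 25 * ((n : ℝ) + 1) + 1 + (9 / 10 * h + ((n : ℝ) + 1) / 5) ≤ 3 / 5 * h * (9 / 20 * ℓ) := by
    have hten : 10 * h ≤ (n : ℝ) + 1 := by nlinarith only [hhℓ, hℓ, hh]
    nlinarith only [hhℓ, hten, hn', hh]
  calc ‖(n : ℂ) - (h : ℂ) * D‖ ≤ |(n : ℝ) - h * D.re| + |h * D.im| := hN
    _ ≤ 3 / 25 * ((n : ℝ) + 1) + 1 + (9 / 10 * h + ((n : ℝ) + 1) / 5) := add_le_add h1 h2
    _ ≤ 3 / 5 * h * (9 / 20 * ℓ) := h3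
    _ ≤ 3 / 5 * h * ‖D‖ := mul_le_mul_of_nonneg_left hnormD (by linarith)

/-- **Derivative of the fixed-point map** `u ↦ n/D(u)` on the disc and the contraction bound
`‖(n/D)′(u)‖ ≤ ½`. [folklore] -/
theorem hasDerivAt_div_saddleDen (hx : |x| ≤ 1 / 2) (hT : 100 ≤ T) (hℓ : 20 ≤ ell T)
    (hn : 100 ≤ n) (hh : 1 / 2 ≤ bandRadius n T) (hhT : bandRadius n T ≤ 7 / 20 * T)
    (hu : ‖u - ((x : ℂ) + (T : ℂ) * I + bandRadius n T)‖ ≤ 3 / 5 * bandRadius n T) :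
    ∃ N' : ℂ, HasDerivAt (fun w : ℂ => (n : ℂ) / saddleDen n ((x : ℂ) + (T : ℂ) * I) w) N' u ∧
      ‖N'‖ ≤ 1 / 2 := by
  set h := bandRadius n T with hhdef
  set ℓ := ell T with hℓdef
  set c : ℂ := (x : ℂ) + (T : ℂ) * I with hc
  set s : ℂ := 1 / 2 + u with hs
  obtain ⟨him_lo, him_hi, hre_lo, hre_hi, hns_lo, hns_hi, hnu_lo, hucim, hucre, hnuc⟩ :=
    disc_geometry hx hT hh hhT hu
  rw [← hc] at hucim hucre hnuc
  rw [← hs] at him_lo him_hi hre_lo hre_hi hns_lo hns_hi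
  have hT0 : 0 < T := by linarith
  have hhℓ : h * ℓ = 2 * ((n : ℝ) + 1) := bandRadius_mul_ell hℓ
  obtain ⟨hD0, -⟩ := norm_div_saddleDen_sub_le hx hT hℓ hn hh hhT hu
  obtain ⟨hR_lo, -, -, -⟩ := saddleDen_re_im_bounds hx hT hℓ hh hhT hu
  set D := saddleDen n c u with hD
  have him0 : 0 < s.im := him_lo.trans_lt' (by linarith)
  have hu0 : u ≠ 0 := by
    intro h0; rw [h0, norm_zero] at hnu_lo; linarith
  have huc0 : u + c ≠ 0 := by
    intro h0; rw [h0, norm_zero] at hnuc; linarith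
  -- derivative of `lamPrime` at `s`
  set L : ℂ := -1 / s ^ 2 - 1 / (s - 1) ^ 2 + deriv Complex.digamma (s / 2) / 4 with hL
  have hlam : HasDerivAt lamPrime L s := by
    unfold lamPrime; exact hasDerivAt_xiGammaLogDeriv him0
  have hlam' : HasDerivAt (fun w : ℂ => lamPrime (1 / 2 + w)) L u := by
    have hid : HasDerivAt (fun w : ℂ => (1 / 2 : ℂ) + w) 1 u := (hasDerivAt_id u).const_add _
    have hlam2 : HasDerivAt lamPrime L ((fun w : ℂ => (1 / 2 : ℂ) + w) u) := by
      simpa only [hs] using hlam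
    have hcomp : HasDerivAt (fun w : ℂ => lamPrime (1 / 2 + w)) (L * 1) u :=
      HasDerivAt.comp u hlam2 hid
    rw [mul_one] at hcomp
    exact hcomp
  have hinv : HasDerivAt (fun w : ℂ => 1 / w) (-(u ^ 2)⁻¹) u := by
    have := hasDerivAt_inv hu0
    simpa only [one_div] using this
  have hfrac : HasDerivAt (fun w : ℂ => ((n : ℂ) + 1) / (w + c)) (-(((n : ℂ) + 1) / (u + c) ^ 2)) u := by
    have h1 : HasDerivAt (fun w : ℂ => (w + c)⁻¹) (-1 / (u + c) ^ 2) u := by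
      have := ((hasDerivAt_id u).add_const c).fun_inv huc0
      simpa using this
    have h2 := h1.const_mul ((n : ℂ) + 1)
    refine h2.congr_deriv ?_ |>.congr_of_eventuallyEq ?_
    · field_simp
    · exact Filter.Eventually.of_forall fun w => by simp [div_eq_mul_inv]
  set D' : ℂ := L - (u ^ 2)⁻¹ + ((n : ℂ) + 1) / (u + c) ^ 2 with hD'
  have hDen : HasDerivAt (fun w : ℂ => saddleDen n c w) D' u := by
    have := (hlam'.add hinv).sub hfrac
    refine this.congr_deriv ?_ |>.congr_of_eventuallyEq ?_
    · rw [hD']; ring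
    · exact Filter.Eventually.of_forall fun w => by simp [saddleDen]
  -- the quotient
  have hN : HasDerivAt (fun w : ℂ => (n : ℂ) / saddleDen n c w) (-((n : ℂ) * D') / D ^ 2) u := by
    have := (hDen.inv hD0).const_mul (n : ℂ)
    refine this.congr_deriv ?_ |>.congr_of_eventuallyEq ?_
    · rw [hD]; field_simp
    · exact Filter.Eventually.of_forall fun w => by simp [div_eq_mul_inv]
  refine ⟨_, hN, ?_⟩
  -- bounds: ‖L‖ ≤ 1/(2‖s‖) + 6/Im s, ‖1/u²‖, ‖(n+1)/(u+c)²‖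
  have hL2 := norm_xiGammaLogDeriv2_sub_le_of_re_nonneg (s := s) (by linarith) (by linarith)
  rw [← hL] at hL2
  have hs0 : s ≠ 0 := by intro h0; rw [h0] at him0; simp at him0
  have hLn : ‖L‖ ≤ 1 / (2 * ‖s‖) + 6 / s.im := by
    have : ‖L‖ ≤ ‖L - 1 / (2 * s)‖ + ‖1 / (2 * s)‖ := by
      have := norm_add_le (L - 1 / (2 * s)) (1 / (2 * s)); rwa [sub_add_cancel] at this
    have e : ‖1 / (2 * s)‖ = 1 / (2 * ‖s‖) := by
      rw [norm_div, norm_one, norm_mul, Complex.norm_two]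
    linarith [e]
  have hLn' : ‖L‖ ≤ 33 / 4 / T := by
    have h1 : 1 / (2 * ‖s‖) ≤ 1 / (2 * (79 / 100 * T)) :=
      one_div_le_one_div_of_le (by positivity) (by linarith)
    have h2 : 6 / s.im ≤ 6 / (79 / 100 * T) :=
      div_le_div_of_nonneg_left (by norm_num) (by positivity) him_lo
    have : 1 / (2 * (79 / 100 * T)) + 6 / (79 / 100 * T) ≤ 33 / 4 / T := by
      rw [div_add_div _ _ (by positivity) (by positivity), div_le_div_iff₀ (by positivity) hT0]
      nlinarith [hT0]
    linarith
  have hu2 : ‖(u ^ 2)⁻¹‖ ≤ 1 / (79 / 100 * T) ^ 2 := by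
    rw [norm_inv, norm_pow, ← one_div]
    exact one_div_le_one_div_of_le (by positivity) (pow_le_pow_left₀ (by positivity) hnu_lo 2)
  have huc2 : ‖((n : ℂ) + 1) / (u + c) ^ 2‖ ≤ ((n : ℝ) + 1) / (179 / 100 * T) ^ 2 := by
    rw [norm_div, norm_pow]
    have hn1 : ‖(n : ℂ) + 1‖ = (n : ℝ) + 1 := by
      rw [show ((n : ℂ) + 1) = ((n + 1 : ℕ) : ℂ) by push_cast; ring, Complex.norm_natCast]; push_cast; ring
    rw [hn1]
    exact div_le_div_of_nonneg_left (by positivity) (by positivity)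
      (pow_le_pow_left₀ (by positivity) hnuc 2)
  have hD'n : ‖D'‖ ≤ 33 / 4 / T + 1 / (79 / 100 * T) ^ 2 + ((n : ℝ) + 1) / (179 / 100 * T) ^ 2 := by
    have := norm_add₃_le (a := L) (b := -(u ^ 2)⁻¹) (c := ((n : ℂ) + 1) / (u + c) ^ 2)
    rw [norm_neg, ← sub_eq_add_neg] at this
    rw [hD']
    linarith
  -- ‖N'‖ = n ‖D'‖ / ‖D‖² ≤ 1/2
  have hnormD : 9 / 20 * ℓ ≤ ‖D‖ := hR_lo.trans ((le_abs_self _).trans (Complex.abs_re_le_norm D))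
  have hD2 : (9 / 20 * ℓ) ^ 2 ≤ ‖D‖ ^ 2 := pow_le_pow_left₀ (by linarith) hnormD 2
  rw [norm_div, norm_neg, norm_mul, Complex.norm_natCast, norm_pow,
    div_le_iff₀ (by positivity : (0 : ℝ) < ‖D‖ ^ 2)]
  have hn' : (n : ℝ) ≤ h * ℓ / 2 := by linarith
  have hτ : h / T ≤ 7 / 20 := by rw [div_le_iff₀ hT0]; linarith
  -- n ‖D'‖ ≤ (hℓ/2)(33/4/T + 1/(0.79T)² + (hℓ/2)/(1.79T)²) ≤ (1/2)(9ℓ/20)²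
  have hℓ0 : 0 < ℓ := by linarith
  have hτ2 : (h / T) ^ 2 ≤ (7 / 20) ^ 2 := pow_le_pow_left₀ (by positivity) hτ 2
  have ka : (h * ℓ / 2) * (33 / 4 / T) ≤ 231 / 160 * ℓ := by
    have e : (h * ℓ / 2) * (33 / 4 / T) = 33 / 8 * (h / T) * ℓ := by
      field_simp
      ring
    rw [e]
    nlinarith only [hτ, hℓ0]
  have kb : (h * ℓ / 2) * (1 / (79 / 100 * T) ^ 2) ≤ 3 / 1000 * ℓ := by
    have e : (h * ℓ / 2) * (1 / (79 / 100 * T) ^ 2) = (h / T) * (1 / T) * (5000 / 6241) * ℓ := by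
      field_simp
      ring
    rw [e]
    have h1T : 1 / T ≤ 1 / 100 := one_div_le_one_div_of_le (by norm_num) hT
    have : (h / T) * (1 / T) ≤ 7 / 20 * (1 / 100) :=
      mul_le_mul hτ h1T (by positivity) (by norm_num)
    nlinarith only [this, hℓ0]
  have kc : (h * ℓ / 2) * ((h * ℓ / 2) / (179 / 100 * T) ^ 2) ≤ 1 / 100 * ℓ ^ 2 := by
    have e : (h * ℓ / 2) * ((h * ℓ / 2) / (179 / 100 * T) ^ 2) = (h / T) ^ 2 * (2500 / 32041) * ℓ ^ 2 := by
      field_simp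
      ring
    rw [e]
    have hℓ2 : 0 < ℓ ^ 2 := by positivity
    nlinarith only [hτ2, hℓ2]
  have key : (h * ℓ / 2) * (33 / 4 / T + 1 / (79 / 100 * T) ^ 2 + ((n : ℝ) + 1) / (179 / 100 * T) ^ 2)
      ≤ 1 / 2 * (9 / 20 * ℓ) ^ 2 := by
    rw [show ((n : ℝ) + 1) = h * ℓ / 2 by linarith only [hhℓ], mul_add, mul_add]
    nlinarith only [ka, kb, kc, hℓ, hℓ0]
  calc (n : ℝ) * ‖D'‖ ≤ (h * ℓ / 2) * (33 / 4 / T + 1 / (79 / 100 * T) ^ 2 +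
        ((n : ℝ) + 1) / (179 / 100 * T) ^ 2) :=
        mul_le_mul hn' hD'n (norm_nonneg _) (by positivity)
    _ ≤ 1 / 2 * (9 / 20 * ℓ) ^ 2 := key
    _ ≤ 1 / 2 * ‖D‖ ^ 2 := by linarith

end den

/-! ## The saddle (Banach fixed point) -/

/-- **Existence of the model saddle (S3).** Under `|x| ≤ ½`, `T ≥ 100`, `ℓ_T ≥ 20`, `n ≥ 100`,
`½ ≤ h(n,T) ≤ (7/20)T`, the saddle function `S_{n,c}` (`c = x + iT`) has a zero `u*` with
`‖u* − (c + h(n,T))‖ ≤ (3/5) h(n,T)` (Banach's fixed-point theorem for `u ↦ c + n/D(u)` on that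
closed disc: it maps the disc into itself and is `½`-Lipschitz there). [folklore] -/
theorem exists_arcSaddleFn_eq_zero {n : ℕ} {x T : ℝ} (hx : |x| ≤ 1 / 2) (hT : 100 ≤ T)
    (hℓ : 20 ≤ ell T) (hn : 100 ≤ n) (hh : 1 / 2 ≤ bandRadius n T)
    (hhT : bandRadius n T ≤ 7 / 20 * T) :
    ∃ u : ℂ, arcSaddleFn n ((x : ℂ) + (T : ℂ) * I) u = 0 ∧
      ‖u - ((x : ℂ) + (T : ℂ) * I + bandRadius n T)‖ ≤ 3 / 5 * bandRadius n T := by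
  set h := bandRadius n T with hhdef
  set c : ℂ := (x : ℂ) + (T : ℂ) * I with hc
  have hh0 : 0 < h := by linarith
  set K : Set ℂ := closedBall (c + h) (3 / 5 * h) with hK
  set N : ℂ → ℂ := fun w => c + (n : ℂ) / saddleDen n c w with hN
  have hmem : ∀ {w : ℂ}, w ∈ K ↔ ‖w - (c + h)‖ ≤ 3 / 5 * h := by
    intro w; rw [hK, mem_closedBall, dist_eq_norm]
  -- maps into
  have hmaps : MapsTo N K K := by
    intro w hw
    rw [hmem] at hw ⊢
    obtain ⟨-, hb⟩ := norm_div_saddleDen_sub_le hx hT hℓ hn hh hhT hw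
    have : N w - (c + h) = (n : ℂ) / saddleDen n c w - h := by rw [hN]; ring
    rw [this]; exact hb
  -- Lipschitz with constant 1/2
  have hlip : LipschitzOnWith (1 / 2 : NNReal) N K := by
    have hconv : Convex ℝ K := convex_closedBall _ _
    have hderiv : ∀ w ∈ K, ∃ N' : ℂ, HasDerivAt N N' w ∧ ‖N'‖ ≤ 1 / 2 := by
      intro w hw
      rw [hmem] at hw
      obtain ⟨N', hN', hb⟩ := hasDerivAt_div_saddleDen hx hT hℓ hn hh hhT hw
      exact ⟨N', by simpa [hN] using hN'.const_add c, hb⟩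
    choose! F hF using hderiv
    refine hconv.lipschitzOnWith_of_nnnorm_hasDerivWithin_le
      (fun w hw => (hF w hw).1.hasDerivWithinAt) fun w hw => ?_
    have := (hF w hw).2
    rw [← NNReal.coe_le_coe, coe_nnnorm]
    push_cast
    exact this
  have hcomplete : IsComplete K := (isClosed_closedBall).isComplete
  have hcontr : ContractingWith (1 / 2 : NNReal) (hmaps.restrict N K K) :=
    ⟨by norm_num, (hmaps.lipschitzOnWith_iff_restrict).1 hlip⟩
  have hx0 : c + (h : ℂ) ∈ K := by rw [hmem]; simp; positivity
  obtain ⟨u, huK, hfix, -⟩ :=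
    hcontr.exists_fixedPoint' hcomplete hmaps hx0 (edist_ne_top _ _)
  refine ⟨u, ?_, (hmem.1 huK)⟩
  -- the fixed point is a zero of the saddle function
  have huK' : ‖u - (c + h)‖ ≤ 3 / 5 * h := hmem.1 huK
  obtain ⟨hD0, -⟩ := norm_div_saddleDen_sub_le hx hT hℓ hn hh hhT huK'
  obtain ⟨-, -, hre_lo, -, -, -, hnu_lo, -⟩ := disc_geometry hx hT hh hhT huK'
  have hre : 0 < (1 / 2 + u).re := by linarith
  have h1 : 1 / 2 + u ≠ 1 := by
    intro h0
    have := congrArg Complex.im h0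
    simp at this
    have him : 79 / 100 * T ≤ ‖u‖ := hnu_lo
    have : |u.im - T| ≤ 3 / 5 * h := (disc_coords huK').1
    rw [abs_le] at this
    linarith
  have huc : u - c ≠ 0 := by
    intro h0
    have : ‖u - (c + h)‖ = h := by
      rw [show u - (c + (h : ℂ)) = (u - c) - h by ring, h0, zero_sub, norm_neg, Complex.norm_real,
        Real.norm_eq_abs, abs_of_pos hh0]
    linarith
  have hfix' : u = c + (n : ℂ) / saddleDen n c u := hfix.symm
  have hn0 : (n : ℂ) ≠ 0 := by exact_mod_cast (show n ≠ 0 by omega)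
  rw [arcSaddleFn_eq_saddleDen_sub n c hre h1]
  have huc' : u - c = (n : ℂ) / saddleDen n c u := by
    nth_rewrite 1 [hfix']; ring
  rw [huc']
  field_simp
  ring





end Summit.RiemannHypothesis.RiemannHypothesis.Theorems.JensenPolynomials.LogBandArc

end
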